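import Summits.AtomisticToContinuum.Crystallization.Theorems.FrustratedLawDichotomyCellRemInterior
import Summits.AtomisticToContinuum.Crystallization.Theorems.FrustratedLawDichotomyCellArithTaylor
import Summits.AtomisticToContinuum.Crystallization.Theorems.FrustratedLawDichotomyCellTriples

/-!
# FrustratedLawDichotomy · crux `AperiodicFrustratedLawGap` (stmt-AtomisticToContinuum-27623) — CELL-ARITH companion: THE FORCE-REMAINDER COLUMN
# AS ONE NUMBER PER CELL («RM BY THE STAR TABLE»; decomp-a2c hand-1 g54, continues `…CellRemInterior`)

`…CellRemInterior.rm_double_sum_eq` puts the (251) `hRM` double sum on interior-adjacent pairs.  Two more elementary steps remove ALL per-pair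
data from the RM column of a Bravais cell:

* §1 ★ `interior_block_le` — the triangle inequality `‖Y x − Y x'‖ ≤ ‖Y x‖ + ‖Y x'‖` and the exchange of the two interior sums (symmetric lists
  and weight) give `Σ_{x,x' interior} ‖Y x − Y x'‖·w ≤ 2·Σ_x Σ_{x'} ‖Y x‖·w`; hence ★★ `half_rm_le_starSum`:
  `½ΣΣ_M ‖YE m − YE m'‖·w ≤ Σ_{x∈MI} Σ_{m'∈(M∖x)∩nbr x} ‖Y x‖·w x m'` — each interior label pays its own STAR.
* §2 ★ `starSum_le_table` — an injective DIFFERENCE KEY `dk x : ι → κ` on `M` (triples: `m' ↦ m' − x`) sending the near partners of `x`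
  into an EXPLICIT finset `D` of differences (the same `D` for every interior label of a Bravais template: lattice differences below `ℓ_r`),
  and a termwise table bound `w x m' ≤ g (dk x m')`, give `Σ_{(M∖x)∩nbr x} ‖Y x‖·w ≤ ‖Y x‖·Σ_{d∈D} g d`.
* §3 the (251) weight: ★ `rmWeight_le_reading` — `forceRem ‖pos x − pos m'‖ (dispL x + dispL m') ≤ forceRemHiZ S rlo rhi η₂/S` for any
  rational `η₂ ≥ 2τ` below the bond's r-bracket `[rlo, rhi]` ((hand-1) `forceRem_mono_right`, (hand-1 g53) `le_forceRemHiZ`); and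
  ★★★ `hRM_of_star` — the `hRM` hypothesis VERBATIM with `RM := (Σ_{x∈MI} yb x)·Σ_{d∈D} g d`: ONE table of `|D|` readings per cell
  (`|D| ≈ 86` lattice differences at `ℓ_r ↔ L_R = 3`) times the interior norm witnesses already used by `fc`/`hf` — NO pair lists at all.
* §4 the triple instance of the difference key: `subT_injOn`, `sqT_subT_comm`.
DEF-FREE; imports TREE `…CellRemInterior` (p860302), `…CellArithTaylor` (p859672), `…CellTriples` (p859824); 0 sorry.  All `[folklore]`.
-/

noncomputable section

namespace Summit.AtomisticToContinuum.Crystallization.Theorems.FrustratedLawDichotomyCellRemStar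

open Metric Set
open scoped BigOperators
open Summit.AtomisticToContinuum.Crystallization.Theorems.ChargedEnergyGapNegative (E3)
open Summit.AtomisticToContinuum.Crystallization.Theorems.FrustratedLawDichotomyCoherentFloorAlgebra (forceRem)
open Summit.AtomisticToContinuum.Crystallization.Theorems.FrustratedLawDichotomyCertFloorTailsRem (forceRem_nonneg forceRem_mono_right)
open Summit.AtomisticToContinuum.Crystallization.Theorems.FrustratedLawDichotomyCellFrame (YE dispL)
open Summit.AtomisticToContinuum.Crystallization.Theorems.FrustratedLawDichotomyCellTailsRem (dispL_add_mem)
open Summit.AtomisticToContinuum.Crystallization.Theorems.FrustratedLawDichotomyCellClasses (ballL)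
open Summit.AtomisticToContinuum.Crystallization.Theorems.FrustratedLawDichotomyCellTriples (subT sqT)
open Summit.AtomisticToContinuum.Crystallization.Theorems.FrustratedLawDichotomyCellArith (le_div_of_reading)
open Summit.AtomisticToContinuum.Crystallization.Theorems.FrustratedLawDichotomyCellArithTaylor (forceRemHiZ le_forceRemHiZ)
open Summit.AtomisticToContinuum.Crystallization.Theorems.FrustratedLawDichotomyCellRemInterior

variable {ι : Type*} [DecidableEq ι]

/-! ## §1. Each interior label pays its own star -/

section Generic

variable {M MI : Finset ι} {Y : ι → E3} {nbr : ι → Finset ι} {w : ι → ι → ℝ}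

/-- exchange of the two sums over interior near pairs (symmetric lists on `M`, symmetric weight). [folklore] -/
theorem interior_exchange (hMI : MI ⊆ M) (hsym : ∀ m ∈ M, ∀ m' ∈ M, m' ∈ nbr m → m ∈ nbr m') (hw : ∀ m m', w m m' = w m' m)
    (f : ι → ℝ) :
    ∑ x ∈ MI, ∑ x' ∈ (MI.erase x).filter (fun m' => m' ∈ nbr x), f x' * w x x'
      = ∑ x ∈ MI, ∑ x' ∈ (MI.erase x).filter (fun m' => m' ∈ nbr x), f x * w x x' := by
  rw [Finset.sum_comm' (t' := MI) (s' := fun x' => (MI.erase x').filter (fun x => x ∈ nbr x')) (h := ?_)]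
  · exact Finset.sum_congr rfl fun x' _ => Finset.sum_congr rfl fun x _ => by rw [hw]
  · intro x x'
    simp only [Finset.mem_filter, Finset.mem_erase]
    constructor
    · rintro ⟨hx, ⟨hne, hx'⟩, hn⟩
      exact ⟨⟨⟨fun h => hne h.symm, hx⟩, hsym x (hMI hx) x' (hMI hx') hn⟩, hx'⟩
    · rintro ⟨⟨⟨hne, hx⟩, hn⟩, hx'⟩
      exact ⟨hx, ⟨fun h => hne h.symm, hx'⟩, hsym x' (hMI hx') x (hMI hx) hn⟩

/-- ★ THE INTERIOR BLOCK UNDER THE TRIANGLE INEQUALITY: `Σ_{x,x'} ‖Y x − Y x'‖·w ≤ 2·Σ_{x,x'} ‖Y x‖·w` (`w ≥ 0` symmetric, lists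
symmetric on `M`). [folklore] -/
theorem interior_block_le (hMI : MI ⊆ M) (hsym : ∀ m ∈ M, ∀ m' ∈ M, m' ∈ nbr m → m ∈ nbr m') (hw : ∀ m m', w m m' = w m' m)
    (hw0 : ∀ m m', 0 ≤ w m m') :
    ∑ x ∈ MI, ∑ x' ∈ (MI.erase x).filter (fun m' => m' ∈ nbr x), ‖Y x - Y x'‖ * w x x'
      ≤ 2 * ∑ x ∈ MI, ∑ x' ∈ (MI.erase x).filter (fun m' => m' ∈ nbr x), ‖Y x‖ * w x x' := by
  have h1 : ∑ x ∈ MI, ∑ x' ∈ (MI.erase x).filter (fun m' => m' ∈ nbr x), ‖Y x - Y x'‖ * w x x'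
      ≤ ∑ x ∈ MI, ∑ x' ∈ (MI.erase x).filter (fun m' => m' ∈ nbr x), (‖Y x‖ * w x x' + ‖Y x'‖ * w x x') := by
    refine Finset.sum_le_sum fun x _ => Finset.sum_le_sum fun x' _ => ?_
    rw [← add_mul]
    exact mul_le_mul_of_nonneg_right (norm_sub_le _ _) (hw0 _ _)
  have h2 := interior_exchange hMI hsym hw (fun x => ‖Y x‖)
  simp only [Finset.sum_add_distrib] at h1
  linarith

/-- the star of an interior label splits into interior and exterior partners. [folklore] -/
theorem starSum_split (hMI : MI ⊆ M) {x : ι} (hx : x ∈ MI) (f : ι → ℝ) :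
    ∑ m' ∈ (M.erase x).filter (fun m' => m' ∈ nbr x), f m'
      = ∑ x' ∈ (MI.erase x).filter (fun m' => m' ∈ nbr x), f x' + ∑ m' ∈ (M \ MI).filter (fun m' => m' ∈ nbr x), f m' := by
  rw [← Finset.sum_filter_add_sum_filter_not _ (fun m' => m' ∈ MI), filter_mem_interior hMI, filter_not_mem_interior hx]

/-- ★★ **HALF THE DOUBLE SUM IS AT MOST THE INTERIOR STAR SUM**: for `MI ⊆ M`, lists symmetric on `M`, a symmetric weight `w ≥ 0`,
`½ΣΣ_{m∈M, m'∈(M∖m)∩nbr m} ‖YE m − YE m'‖·w ≤ Σ_{x∈MI} Σ_{m'∈(M∖x)∩nbr x} ‖Y x‖·w x m'`. [folklore] -/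
theorem half_rm_le_starSum (hMI : MI ⊆ M) (hsym : ∀ m ∈ M, ∀ m' ∈ M, m' ∈ nbr m → m ∈ nbr m') (hw : ∀ m m', w m m' = w m' m)
    (hw0 : ∀ m m', 0 ≤ w m m') :
    1 / 2 * ∑ m ∈ M, ∑ m' ∈ (M.erase m).filter (fun m' => m' ∈ nbr m), ‖YE MI Y m - YE MI Y m'‖ * w m m'
      ≤ ∑ x ∈ MI, ∑ m' ∈ (M.erase x).filter (fun m' => m' ∈ nbr x), ‖Y x‖ * w x m' := by
  rw [rm_double_sum_eq hMI hsym hw]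
  have hI := interior_block_le (Y := Y) hMI hsym hw hw0
  have hS : ∀ x ∈ MI, ∑ m' ∈ (M.erase x).filter (fun m' => m' ∈ nbr x), ‖Y x‖ * w x m'
      = ∑ x' ∈ (MI.erase x).filter (fun m' => m' ∈ nbr x), ‖Y x‖ * w x x'
        + ∑ m' ∈ (M \ MI).filter (fun m' => m' ∈ nbr x), ‖Y x‖ * w x m' := fun x hx => starSum_split hMI hx _
  rw [Finset.sum_congr rfl hS, Finset.sum_add_distrib]
  linarith

end Generic

/-! ## §2. The star sum against a table of differences -/

section Table

variable {M : Finset ι} {Y : ι → E3} {nbr : ι → Finset ι} {w : ι → ι → ℝ} {κ : Type*} [DecidableEq κ]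

/-- ★ STAR SUM ≤ TABLE SUM: an injective difference key `dk` on `M` sending the near partners of `x` into an explicit finset `D`, a table
`g ≥ 0` on `D` with `w x m' ≤ g (dk m')` termwise ⇒ `Σ_{m'∈(M∖x)∩nbr x} ‖Y x‖·w x m' ≤ ‖Y x‖·Σ_{d∈D} g d`. [folklore] -/
theorem starSum_le_table {x : ι} (dk : ι → κ) (hinj : Set.InjOn dk ↑M) (D : Finset κ) (g : κ → ℝ)
    (hD : ∀ m' ∈ M, m' ≠ x → m' ∈ nbr x → dk m' ∈ D) (hg : ∀ d ∈ D, 0 ≤ g d)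
    (hwg : ∀ m' ∈ M, m' ≠ x → m' ∈ nbr x → w x m' ≤ g (dk m')) :
    ∑ m' ∈ (M.erase x).filter (fun m' => m' ∈ nbr x), ‖Y x‖ * w x m' ≤ ‖Y x‖ * ∑ d ∈ D, g d := by
  rw [← Finset.mul_sum]
  refine mul_le_mul_of_nonneg_left ?_ (norm_nonneg _)
  set S := (M.erase x).filter (fun m' => m' ∈ nbr x) with hS
  have hSM : S ⊆ M := (Finset.filter_subset _ _).trans (Finset.erase_subset _ _)
  have memS : ∀ {m'}, m' ∈ S → m' ∈ M ∧ m' ≠ x ∧ m' ∈ nbr x := fun hm' => by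
    obtain ⟨h1, h2⟩ := Finset.mem_filter.mp hm'
    exact ⟨Finset.mem_of_mem_erase h1, Finset.ne_of_mem_erase h1, h2⟩
  calc ∑ m' ∈ S, w x m' ≤ ∑ m' ∈ S, g (dk m') :=
        Finset.sum_le_sum fun m' hm' => hwg m' (memS hm').1 (memS hm').2.1 (memS hm').2.2
    _ = ∑ d ∈ S.image dk, g d := (Finset.sum_image (hinj.mono hSM)).symm
    _ ≤ ∑ d ∈ D, g d := by
        refine Finset.sum_le_sum_of_subset_of_nonneg (fun d hd => ?_) fun d hd _ => hg d hd
        obtain ⟨m', hm', rfl⟩ := Finset.mem_image.mp hd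
        exact hD m' (memS hm').1 (memS hm').2.1 (memS hm').2.2

end Table

/-! ## §3. The (251) weight: one number per cell -/

section Master

variable {M MI : Finset ι} {pos Y : ι → E3} {nbr : ι → Finset ι}

/-- ★ THE (251) WEIGHT READ IN `ℤ` at the doubled displacement: for a bond with r-bracket `rlo ≤ ‖pos x − pos m'‖ ≤ rhi` and any rational
`η₂` with `2τ ≤ η₂ < rlo`: `forceRem ‖pos x − pos m'‖ (dispL o τ x + dispL o τ m') ≤ forceRemHiZ S rlo rhi η₂ / S`. [folklore] -/
theorem rmWeight_le_reading {S : ℤ} (o : ι) {τ : ℝ} (hτ0 : 0 ≤ τ) {rlo rhi η₂ : ℚ} (hS : 0 < S) (hη₂ : 2 * τ ≤ (η₂ : ℝ))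
    (hlo : η₂ < rlo) {x m' : ι} (h1 : (rlo : ℝ) ≤ ‖pos x - pos m'‖) (h2 : ‖pos x - pos m'‖ ≤ (rhi : ℝ)) :
    forceRem ‖pos x - pos m'‖ (dispL o τ x + dispL o τ m') ≤ ((forceRemHiZ S rlo rhi η₂ : ℤ) : ℝ) / S := by
  obtain ⟨hη0, hη2⟩ := dispL_add_mem o hτ0 x m'
  have hη₂0 : (0 : ℝ) ≤ η₂ := by linarith
  have hr : (η₂ : ℝ) < ‖pos x - pos m'‖ := lt_of_lt_of_le (by exact_mod_cast hlo) h1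
  have hmono := forceRem_mono_right (r := ‖pos x - pos m'‖) hη0 (hη2.trans hη₂) hr
  have hread := le_forceRemHiZ (r := ‖pos x - pos m'‖) hS (by exact_mod_cast hη₂0) hlo h1 h2
  exact hmono.trans (le_div_of_reading hS hread)

/-- ★★★ **THE `hRM` HYPOTHESIS OF (251) FROM ONE TABLE.**  `MI ⊆ M`, lists symmetric on `M`, `0 ≤ τ`; for each interior label an injective
difference key `dk x` on `M` sending its near partners into ONE explicit finset `D` (Bravais cells: the lattice differences below `ℓ_r`, the
same for every `x`), a table `g ≥ 0` on `D` dominating the weight termwise (`rmWeight_le_reading` per difference class), and interior norm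
witnesses `‖Y x‖ ≤ yb x` ⇒ `½ΣΣ_M ‖YE m − YE m'‖·forceRem … ≤ (Σ_{x∈MI} yb x)·Σ_{d∈D} g d` — an `RM` with NO pair list. [folklore] -/
theorem hRM_of_star (o : ι) {τ : ℝ} (hτ0 : 0 ≤ τ) (hMI : MI ⊆ M) (hsym : ∀ m ∈ M, ∀ m' ∈ M, m' ∈ nbr m → m ∈ nbr m')
    {κ : Type*} [DecidableEq κ] (dk : ι → ι → κ) (hinj : ∀ x ∈ MI, Set.InjOn (dk x) ↑M) (D : Finset κ) (g : κ → ℝ)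
    (hg : ∀ d ∈ D, 0 ≤ g d) (hD : ∀ x ∈ MI, ∀ m' ∈ M, m' ≠ x → m' ∈ nbr x → dk x m' ∈ D)
    (hwg : ∀ x ∈ MI, ∀ m' ∈ M, m' ≠ x → m' ∈ nbr x →
      forceRem ‖pos x - pos m'‖ (dispL o τ x + dispL o τ m') ≤ g (dk x m'))
    (yb : ι → ℝ) (hyb : ∀ x ∈ MI, ‖Y x‖ ≤ yb x) :
    1 / 2 * ∑ m ∈ M, ∑ m' ∈ (M.erase m).filter (fun m' => m' ∈ nbr m),
        ‖YE MI Y m - YE MI Y m'‖ * forceRem ‖pos m - pos m'‖ (dispL o τ m + dispL o τ m')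
      ≤ (∑ x ∈ MI, yb x) * ∑ d ∈ D, g d := by
  have hG : 0 ≤ ∑ d ∈ D, g d := Finset.sum_nonneg hg
  refine (half_rm_le_starSum (Y := Y) (w := fun m m' => forceRem ‖pos m - pos m'‖ (dispL o τ m + dispL o τ m')) hMI hsym
    (rmWeight_symm o τ) (rmWeight_nonneg o hτ0)).trans ?_
  rw [Finset.sum_mul]
  refine Finset.sum_le_sum fun x hx => ?_
  refine (starSum_le_table (w := fun m m' => forceRem ‖pos m - pos m'‖ (dispL o τ m + dispL o τ m')) (dk x) (hinj x hx) D g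
    (hD x hx) hg (hwg x hx)).trans ?_
  exact mul_le_mul_of_nonneg_right (hyb x hx) hG

end Master

/-! ## §4. The difference key of integer triples -/

omit [DecidableEq ι] in
/-- `m' ↦ m' − x` is injective (on any set of triples): the difference key of a Bravais cell. [folklore] -/
theorem subT_injOn (x : ℤ × ℤ × ℤ) (M : Finset (ℤ × ℤ × ℤ)) : Set.InjOn (fun m' => subT m' x) ↑M := by
  intro m _ m' _ h
  obtain ⟨a, b, c⟩ := m
  obtain ⟨a', b', c'⟩ := m'
  simp only [subT, Prod.mk.injEq] at h
  obtain ⟨h1, h2, h3⟩ := h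
  simp only [Prod.mk.injEq]
  refine ⟨by omega, by omega, by omega⟩

omit [DecidableEq ι] in
/-- the list test is a function of the difference key: `sqT (m' − x) = sqT (x − m')`. [folklore] -/
theorem sqT_subT_comm (x m' : ℤ × ℤ × ℤ) : sqT (subT m' x) = sqT (subT x m') := by
  simp only [sqT, subT]; ring

/-! ## §5. Bond vectors of integer-triple templates through the difference key (appended, hand-1 g54): the `hwg` plumbing of a Floor
file — `pos x − pos m'` IS the template image of `subT x m'`, and its norm is symmetric in the key order `subT m' x`. -/

open Summit.AtomisticToContinuum.Crystallization.Theorems.FrustratedLawDichotomyCellMetric (posL posL_sub)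
open Summit.AtomisticToContinuum.Crystallization.Theorems.FrustratedLawDichotomyCellTriples (zT zT_sub)

omit [DecidableEq ι] in
/-- the cast label vector of a difference is the difference of the cast label vectors. [folklore] -/
theorem cast_zT_subT (x m' : ℤ × ℤ × ℤ) :
    (fun i => (zT (subT x m') i : ℝ)) = (fun i => (zT x i : ℝ)) - fun i => (zT m' i : ℝ) := by
  funext i
  simp only [Pi.sub_apply, ← zT_sub]
  push_cast
  rfl

omit [DecidableEq ι] in
/-- ★ LINEAR template: `pos x − pos m' = posL F (T *ᵥ zT (x − m'))`. [folklore] -/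
theorem posL_linTemplate_sub (F T : Matrix (Fin 3) (Fin 3) ℝ) (x m' : ℤ × ℤ × ℤ) :
    posL F (T.mulVec fun i => (zT x i : ℝ)) - posL F (T.mulVec fun i => (zT m' i : ℝ))
      = posL F (T.mulVec fun i => (zT (subT x m') i : ℝ)) := by
  rw [cast_zT_subT, Matrix.mulVec_sub, posL_sub]

omit [DecidableEq ι] in
/-- ★ ISOTROPIC template: `pos x − pos m' = posL F (h • zT (x − m'))`. [folklore] -/
theorem posL_intTemplate_sub (F : Matrix (Fin 3) (Fin 3) ℝ) (h : ℝ) (x m' : ℤ × ℤ × ℤ) :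
    posL F (fun i => h * (zT x i : ℝ)) - posL F (fun i => h * (zT m' i : ℝ)) = posL F (fun i => h * (zT (subT x m') i : ℝ)) := by
  rw [← posL_sub]
  congr 1
  funext i
  simp only [Pi.sub_apply, ← zT_sub]
  push_cast
  ring

omit [DecidableEq ι] in
/-- the norm of a template bond does not see the order of the difference key (`subT x m'` vs `subT m' x`). [folklore] -/
theorem norm_posL_linTemplate_subT_comm (F T : Matrix (Fin 3) (Fin 3) ℝ) (x m' : ℤ × ℤ × ℤ) :
    ‖posL F (T.mulVec fun i => (zT (subT x m') i : ℝ))‖ = ‖posL F (T.mulVec fun i => (zT (subT m' x) i : ℝ))‖ := by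
  rw [← posL_linTemplate_sub, ← posL_linTemplate_sub, norm_sub_rev]

omit [DecidableEq ι] in
/-- the same for the isotropic template. [folklore] -/
theorem norm_posL_intTemplate_subT_comm (F : Matrix (Fin 3) (Fin 3) ℝ) (h : ℝ) (x m' : ℤ × ℤ × ℤ) :
    ‖posL F (fun i => h * (zT (subT x m') i : ℝ))‖ = ‖posL F (fun i => h * (zT (subT m' x) i : ℝ))‖ := by
  rw [← posL_intTemplate_sub, ← posL_intTemplate_sub, norm_sub_rev]

end Summit.AtomisticToContinuum.Crystallization.Theorems.FrustratedLawDichotomyCellRemStar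

end
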